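import Summits.BirchSwinnertonDyer.BirchSwinnertonDyer.Theses.UniversalToricDescent
import Summits.BirchSwinnertonDyer.BirchSwinnertonDyer.Theorems.UniversalToricDescentTwinAlgMuZeroAtThreeOfBetaRoadParam
import Literature.NumberTheory.EllipticCurves.AnticyclotomicRankinSelbergPAdicLFunction
import Literature.NumberTheory.EllipticCurves.LiuZhangZhang2018.PAdicWaldspurgerEllipticCurveAdditiveRamifiedTwisted
import Mathlib.NumberTheory.Padics.Complex
import Mathlib.Analysis.Normed.Group.Ultra
import HarnessLib

/-!
# Crux 24737 `TwinAlgMuZeroAtThree` — NODE `lzz_character_squeeze` (crux-ideate g10, idea `lzz-character-squeeze`)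

D-0171 node for `stmt-BirchSwinnertonDyer-24737` (NOT registered; the registered skeleton of record stays `Lines/beta_road.lean` v19).
Companion cards: `Ideas/lzz-character-squeeze.md` (crux idea), `Lines/lzz_character_squeeze.md` (node card, tags, instrument data).

THESIS OF THE LINE (bucket B = multiplicative très ramifié twins `E′`, `3 ∥ N′`, `a₃(E′) = ±1`; `K` classical Heegner, `3 = 𝔭𝔭′`).
The registered line asks K1‴ `PrincipalHeegnerIndivisibleMultOfParamAtThree` (local `3`-indivisibility of ONE layer trace
`z_k = Tr_{K[3^{k+1}]/K_k} x_{k+1}` at `𝔭`).  Every printed FINITE-LAYER `p`-adic period formula that could decide it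
(Bertolini–Darmon–Prasanna; Castella–Hsieh 2018 Thm. 4.8, hypothesis (H): `p ∤ 2Nφ(N)`; Castella 2018 (JIMJ / CJM) at `p ∣ N`:
`a_p = 1`, `p ≥ 5`, or a nonsplit `q ∣ M` with `ρ̄` ramified) is OUT OF SCOPE at `3 ∥ N′`, `N′⁻ = 1` (KEEPKILL g5 l.61: «no printed
bottom-layer formula at p = 3»; row 10 `one-point-squeeze` S4 = a PORT).  The lever of this node is the representation-theoretic
`p`-adic Waldspurger formula of Liu–Zhang–Zhang (Duke 167 (2018) Thm. 1.5.3, held offprint p. 749 L6–18): for EVERY finite-order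
character `χ ∈ Ξ(π)` — including ring-class characters of conductor `3^{k+1}`, ramified at `𝔓` — and every pair of test vectors,
`P(φ₁,χ)·P(φ₂,χ⁻¹) = 𝓛(π)(χ) · ι⁻¹[L(½,π_p⊗χ_{𝔓ᶜ})²/ε(½,ψ,π_p⊗χ_{𝔓ᶜ})] · α′(φ₁,φ₂;χ)`, under the SOLE hypothesis `p` split in
`K` — valid at `p = 3 ∥ N′` (tree story `Literature.NumberTheory.EllipticCurves.LiuZhangZhang2018`, χ-sums `heegnerCharLogSum`).  With
`φ = f^*log_ω` the left side is `(Σ_σ χ(σ) log_ω y^σ)(Σ_σ χ⁻¹(σ) log_ω y^σ)` = the χ-ISOTYPIC formal logarithm of the conductor-`3^{k+1}`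
Heegner point.  Chain (children W1–W4 of K1‴, see `stub_principalHeegner`):
  W1 (PRINT)  LZZ Thm. 1.5.3 at ramified `χ` of conductor `3^{k+1}`;
  W2 (IDEA-NEEDED, shared with the X2 kernel p502241) currency matching `𝓛_{LZZ}|_Γ ≐ 𝒫_{Hsieh}² · (explicit analytic factor)` on the
      anticyclotomic line — the ONLY unprinted analytic input (audit flag F-g10-LZZ-RL on the tree reading (R-L));
  W3 (TREE FACT) Hsieh 2014 Thm. B at any level (`Hsieh2014.thmB_exists_isHsiehLFunction_coeff_norm_eq_one_unrPeriod_anyLevel`): the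
      Hsieh series has a norm-one coefficient, hence — by the SQUEEZE LEMMA of §1, PROVED here in the crux's own currency
      (`UnrSeries`, `HasValueAt`, coefficient norms) — its values at primitive characters of conductor `3ⁿ` have valuation
      `λ/φ(3ⁿ) → 0`;
  W4 (ATTACKABLE) height-one χ-isotypic Kummer lemma + constant bookkeeping (`a₃ = ±1`: `Ê′ ≅` twisted `𝔾̂_m`, no Kobayashi defect;
      Gauss sum `v₃(𝔤(χ)) = k/2`, Euler factor `(1 − a₃χ(𝔭)/3)²` of valuation `−2`, `ε`-factor a unit, CST Prop. 3.12 rows `c > 0`):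
      «`v₃(e_χ log_ω z) < 1 + v₃(log g_χ)` ⟹ `z ∉ 3·E′(K_{k,𝔓}) + tors`» ⟹ K1‴ at that layer.
Bucket C₀ is the registered constant C₀′ BY NAME; K2a‴ is the registered line-residual BY NAME.

HONEST FRAMING: nothing of K1‴/K2a‴/C₀′ is discharged; three `sorry`s (the three by-name stubs) and nowhere else.  What is PROVED here:
§1 the squeeze lemma (`norm_tsum_eq_pow_of_coeff`, `UnrSeries.exists_radius_norm_value_eq_pow`) and §2 its reading on the crux's own
conclusion (`squeeze_of_crux`: the crux ⟹ the twin characteristic series takes values of norm `‖x‖^λ` near the boundary — the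
INSTRUMENTABLE shadow of `μ = 0` at deep characters, I-g10-1).
-/

set_option linter.dupNamespace false
set_option autoImplicit false
set_option maxHeartbeats 800000

noncomputable section

open scoped Classical

namespace Summit.BirchSwinnertonDyer.BirchSwinnertonDyer.Cruxes.TwinAlgMuZeroAtThree.LzzCharacterSqueeze

open Literature.NumberTheory.EllipticCurves
open Summit.BirchSwinnertonDyer.BirchSwinnertonDyer.Theorems

/-! ## §1 The squeeze lemma (PROVED): a bounded series with a norm-one coefficient has values of norm `‖x‖^λ` near the boundary -/

variable {p : ℕ} [Fact p.Prime]

/-- **Squeeze lemma, sequence form (PROVED).**  Let `a : ℕ → ℂ_p` be bounded by `1`, with `‖a d‖ = 1` and `‖a k‖ < 1` for `k < d`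
(`d` = the Weierstrass `λ` of a `μ = 0` series).  Then there is `r < 1` such that for every `x` with `r < ‖x‖ < 1`,
`‖∑ a_k x^k‖ = ‖x‖^d` EXACTLY: the `d`-th term strictly dominates (`k > d`: `‖x‖^k ≤ ‖x‖^{d+1}`; `k < d`: finitely many,
`‖a_k‖ ≤ ρ < ‖x‖^d` for `‖x‖` close to `1`), and `ℂ_p` is ultrametric.  For `x = ζ_{pⁿ} − 1` this is Washington's
`v(f(ζ−1)) = λ·v(ζ−1) → 0`.  [cite: Washington1997, §7.1 Prop. 7.2–Thm. 7.3 and §7.2] [cite: LangCyclotomic1990, Ch. 5 §2 Thm. 2.2] -/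
theorem norm_tsum_eq_pow_of_coeff {a : ℕ → ℂ_[p]} {d : ℕ} (hle : ∀ k, ‖a k‖ ≤ 1) (hd : ‖a d‖ = 1)
    (hlt : ∀ k < d, ‖a k‖ < 1) :
    ∃ r : ℝ, r < 1 ∧ ∀ x : ℂ_[p], r < ‖x‖ → ‖x‖ < 1 →
      Summable (fun k ↦ a k * x ^ k) ∧ ‖∑' k, a k * x ^ k‖ = ‖x‖ ^ d := by
  -- the lower coefficients are uniformly smaller: `‖a k‖ ≤ ρ` for `k < d`, some `0 ≤ ρ < 1`
  obtain ⟨ρ, hρ0, hρ1, hρ⟩ : ∃ ρ : ℝ, 0 ≤ ρ ∧ ρ < 1 ∧ ∀ k < d, ‖a k‖ ≤ ρ := by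
    by_cases hd0 : d = 0
    · exact ⟨0, le_rfl, one_pos, fun k hk ↦ absurd hk (by omega)⟩
    · have hne : (Finset.range d).Nonempty := Finset.nonempty_range_iff.mpr hd0
      obtain ⟨k₀, hk₀, hmax⟩ := Finset.exists_max_image (Finset.range d) (fun k ↦ ‖a k‖) hne
      exact ⟨‖a k₀‖, norm_nonneg _, hlt k₀ (Finset.mem_range.mp hk₀), fun k hk ↦ hmax k (Finset.mem_range.mpr hk)⟩
  -- radii close to `1`: `ρ < ‖x‖^d`
  have hev : ∀ᶠ t : ℝ in nhds 1, ρ < t ^ d :=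
    ((continuous_pow d).tendsto (1 : ℝ)).eventually_const_lt (by rw [one_pow]; exact hρ1)
  obtain ⟨ε, hε, hball⟩ := Metric.eventually_nhds_iff.mp hev
  refine ⟨max (1 - ε) 0, max_lt (by linarith) one_pos, fun x hrx hx1 ↦ ?_⟩
  have hrx' : 1 - ε < ‖x‖ := lt_of_le_of_lt (le_max_left _ _) hrx
  have hx0' : 0 < ‖x‖ := lt_of_le_of_lt (le_max_right _ _) hrx
  have hxd : ρ < ‖x‖ ^ d := hball (by rw [Real.dist_eq, abs_sub_comm, abs_of_pos (by linarith)]; linarith)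
  have hx0 : 0 ≤ ‖x‖ := norm_nonneg _
  set f : ℕ → ℂ_[p] := fun k ↦ a k * x ^ k with hf_def
  -- summability (domination by the geometric series `‖x‖^k`)
  have hs : Summable f := by
    refine Summable.of_norm_bounded (g := fun k ↦ ‖x‖ ^ k) (summable_geometric_of_lt_one hx0 hx1) fun k ↦ ?_
    rw [hf_def, norm_mul, norm_pow]
    exact mul_le_of_le_one_left (pow_nonneg hx0 _) (hle k)
  refine ⟨hs, ?_⟩
  -- split off the dominant term
  have hsplit : ∑' k, f k = f d + ∑' k, (if k = d then 0 else f k) := hs.tsum_eq_add_tsum_ite d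
  set C : ℝ := max (‖x‖ ^ (d + 1)) ρ with hC_def
  have hC0 : 0 ≤ C := le_max_of_le_right hρ0
  have hdom : ‖f d‖ = ‖x‖ ^ d := by rw [hf_def, norm_mul, norm_pow, hd, one_mul]
  have hClt : C < ‖x‖ ^ d := by
    refine max_lt ?_ hxd
    rw [pow_succ]
    exact mul_lt_of_lt_one_right (pow_pos hx0' _) hx1
  have hrem : ‖∑' k, (if k = d then 0 else f k)‖ ≤ C := by
    refine IsUltrametricDist.norm_tsum_le_of_forall_le_of_nonneg hC0 fun k ↦ ?_
    by_cases hkd : k = d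
    · rw [if_pos hkd, norm_zero]; exact hC0
    · rw [if_neg hkd, hf_def, norm_mul, norm_pow]
      rcases lt_or_gt_of_ne hkd with hk | hk
      · calc ‖a k‖ * ‖x‖ ^ k ≤ ‖a k‖ * 1 :=
              mul_le_mul_of_nonneg_left (pow_le_one₀ hx0 hx1.le) (norm_nonneg _)
          _ ≤ ρ := by rw [mul_one]; exact hρ k hk
          _ ≤ C := le_max_right _ _
      · calc ‖a k‖ * ‖x‖ ^ k ≤ 1 * ‖x‖ ^ (d + 1) :=
              mul_le_mul (hle k) (pow_le_pow_of_le_one hx0 hx1.le (by omega)) (pow_nonneg hx0 _) zero_le_one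
          _ = ‖x‖ ^ (d + 1) := one_mul _
          _ ≤ C := le_max_left _ _
  have hne : ‖f d‖ ≠ ‖∑' k, (if k = d then 0 else f k)‖ := by
    rw [hdom]; exact ne_of_gt (hrem.trans_lt hClt)
  change ‖∑' k, f k‖ = ‖x‖ ^ d
  rw [hsplit, IsUltrametricDist.norm_add_eq_max_of_norm_ne_norm hne, max_eq_left, hdom]
  rw [hdom]; exact (hrem.trans_lt hClt).le

/-- Coefficients of an `R₀⟦T⟧`-series have norm `≤ 1` in `ℂ_p` (`R₀ ⊆ 𝒪_{ℂ_p}`, tree `unrIntegers_le_padicComplexInt`).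
[cite: Castella2018, §3 (arXiv:1704.06608 p. 9)] -/
theorem norm_coe_unrIntegers_le_one (c : unrIntegers p) : ‖(c : ℂ_[p])‖ ≤ 1 := by
  have hc : (c : ℂ_[p]) ∈ PadicComplexInt p := unrIntegers_le_padicComplexInt c.2
  rw [PadicComplexInt, Valuation.mem_valuationSubring_iff] at hc
  have := hc
  rw [PadicComplex.norm_eq_norm, Valuation.norm_def] at *
  simpa using this

/-- **Squeeze lemma in the crux's currency (PROVED).**  If `L ∈ R₀⟦T⟧` has a coefficient of norm `1` (the `μ = 0` clause
`∃ i, ‖[Tⁱ]L‖ = 1` of `TwinAlgMuZeroAtThree`), let `d` be the least such index; then for `x` in an annulus `r < ‖x‖ < 1` every value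
`L(x)` (`UnrSeries.HasValueAt`) has norm EXACTLY `‖x‖^d`.  At a primitive character `χ` of `Γ` of order `pⁿ` (`x = χ(γ) − 1`,
`‖x‖ = p^{-1/φ(pⁿ)} → 1`) this reads `v_p(L(χ)) = d/φ(pⁿ) → 0`: the values at deep characters are SQUEEZED to valuation `→ 0`.
[cite: Washington1997, §7.2] -/
theorem UnrSeries.exists_radius_norm_value_eq_pow (L : UnrSeries p)
    (hμ : ∃ i : ℕ, ‖((PowerSeries.coeff i L : unrIntegers p) : ℂ_[p])‖ = 1) :
    ∃ (d : ℕ) (r : ℝ), ‖((PowerSeries.coeff d L : unrIntegers p) : ℂ_[p])‖ = 1 ∧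
      (∀ k < d, ‖((PowerSeries.coeff k L : unrIntegers p) : ℂ_[p])‖ < 1) ∧ r < 1 ∧
      ∀ x v : ℂ_[p], r < ‖x‖ → ‖x‖ < 1 → L.HasValueAt x v → ‖v‖ = ‖x‖ ^ d := by
  classical
  refine ⟨Nat.find hμ, ?_⟩
  have hd : ‖((PowerSeries.coeff (Nat.find hμ) L : unrIntegers p) : ℂ_[p])‖ = 1 := Nat.find_spec hμ
  have hlt : ∀ k < Nat.find hμ, ‖((PowerSeries.coeff k L : unrIntegers p) : ℂ_[p])‖ < 1 := fun k hk ↦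
    lt_of_le_of_ne (norm_coe_unrIntegers_le_one _) (Nat.find_min hμ hk)
  obtain ⟨r, hr1, hr⟩ := norm_tsum_eq_pow_of_coeff (a := fun k ↦ ((PowerSeries.coeff k L : unrIntegers p) : ℂ_[p]))
    (fun k ↦ norm_coe_unrIntegers_le_one _) hd hlt
  refine ⟨r, hd, hlt, hr1, fun x v hrx hx1 hv ↦ ?_⟩
  obtain ⟨hs, hnorm⟩ := hr x hrx hx1
  have hv' : v = ∑' k, ((PowerSeries.coeff k L : unrIntegers p) : ℂ_[p]) * x ^ k := (hs.hasSum.unique hv).symm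
  rw [hv', hnorm]

/-! ## §2 Reading on the crux (PROVED): the crux ⟹ the twin characteristic series is squeezed at deep characters -/

/-- **Crux ⟹ squeeze of the characteristic series (INSTRUMENTABLE shadow of `μ = 0`).**  From `TwinAlgMuZeroAtThree` BY NAME: for
every admissible datum, the characteristic ideal of `X_(∅,0)` read in `R₀⟦T⟧` is generated by a series `g′` whose values on an annulus
`r < ‖x‖ < 1` have norm exactly `‖x‖^d` for one `d` (its `λ`).  This is what instrument I-g10-1 measures from the other side
(valuations of χ-twisted log sums / `L`-values at conductor `9, 27` on the habitat `15a1/ℚ(√−11)`).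
[cite: Washington1997, §7.2] [cite: GreenbergVatsal2000, §2 Prop. (2.8)] -/
theorem squeeze_of_crux
    (h : Summit.BirchSwinnertonDyer.BirchSwinnertonDyer.Theses.UniversalToricDescent.TwinAlgMuZeroAtThree) :
    ∀ (W' : WeierstrassCurve ℚ) [W'.IsElliptic] [W'.IsGloballyMinimal] (N' : ℕ) [NeZero N']
      (K : Type) [Field K] [NumberField K]
      (Dt' : Literature.NumberTheory.EllipticCurves.ModularForms.ModularParametrizationData W' N'),
      (Literature.NumberTheory.EllipticCurves.Rank1Residual.Mult W' 3 ∧ ¬ 3 ∣ padicValInt 3 W'.minimalDiscriminantInt ∨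
        Literature.NumberTheory.EllipticCurves.Rank1Residual.GoodSS W' 3 ∧ W'.frobeniusTrace 3 = 0) →
      W'.HasSurjectiveModNGaloisRep 3 → W'.conductorNorm ℤ = N' →
      Literature.NumberTheory.EllipticCurves.IsImaginaryQuadratic K →
      Literature.NumberTheory.EllipticCurves.SatisfiesHeegnerHypothesis N' K → Odd (NumberField.discr K) →
      ∀ (κ : Literature.NumberTheory.EllipticCurves.ZpExtension K 3), κ.IsAnticyclotomic →
      ∀ (γ : Field.absoluteGaloisGroup K) [Fact (κ.IsTopGenerator γ)]
        (𝔭 : IsDedekindDomain.HeightOneSpectrum (NumberField.RingOfIntegers K)),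
        ((3 : ℕ) : NumberField.RingOfIntegers K) ∈ 𝔭.asIdeal →
        𝔭.asIdeal.ramificationIdx (NumberField.RingOfIntegers ℚ) = 1 →
        𝔭.asIdeal.inertiaDeg (NumberField.RingOfIntegers ℚ) = 1 →
      ∀ (𝔭' : IsDedekindDomain.HeightOneSpectrum (NumberField.RingOfIntegers K)),
        ((3 : ℕ) : NumberField.RingOfIntegers K) ∈ 𝔭'.asIdeal → 𝔭' ≠ 𝔭 →
      ∃ (g' : UnrSeries 3) (d : ℕ) (r : ℝ),
        (Summit.BirchSwinnertonDyer.Rank1Residual.X11b.AcSelmer.XAc.charIdeal (W'.baseChange K) 3 κ 𝔭' ∅ γ).map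
            (PowerSeries.map (Summit.BirchSwinnertonDyer.Rank1Residual.X11b.Halves.toUnr 3)) = Ideal.span {g'} ∧
        r < 1 ∧ ∀ x v : ℂ_[3], r < ‖x‖ → ‖x‖ < 1 → g'.HasValueAt x v → ‖v‖ = ‖x‖ ^ d := by
  intro W' _ _ N' _ K _ _ Dt' hbucket hsurj hN hK hH hodd κ hκ γ _ 𝔭 h𝔭 he hf 𝔭' h𝔭' hne
  obtain ⟨-, g', hg', hμ⟩ := h W' N' K Dt' hbucket hsurj hN hK hH hodd κ hκ γ 𝔭 h𝔭 he hf 𝔭' h𝔭' hne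
  obtain ⟨d, r, -, -, hr1, hval⟩ := UnrSeries.exists_radius_norm_value_eq_pow g' hμ
  exact ⟨g', d, r, hg', hr1, hval⟩

/-! ## §3 The stubs of the node (the ONLY `sorry`s of this file): K1‴, K2a‴, C₀′ BY NAME -/

/-- **stub K1‴** (`PrincipalHeegnerIndivisibleMultOfParamAtThree`, registered in `Lines/beta_road.lean` v19) — UNDECIDED; this node's
plan under it (children, tags; details in `Lines/lzz_character_squeeze.md`):
* W1 PRINT — Liu–Zhang–Zhang, Duke 167 (2018) Thm. 1.5.3 at a ring-class character `χ` of conductor `3^{k+1}` (finite order, ramified at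
  `𝔓`; `χ ∈ Ξ` is a condition away from `p`), test vector `φ = f^*log_ω` (resp. its translate by the Heegner vector): the χ-isotypic
  squared log-period `heegnerCharLogSum ι ιK 3^{k+1} W′ χ y · heegnerCharLogSum ι ιK 3^{k+1} W′ χ⁻¹ y` equals
  `𝓛(π)(χ)·ι⁻¹[L²/ε]·α′(χ)`.  [held offprint `pub/bsd-eis/lit/src/lzz18-duke/txt/p0007` L6–18; tree readings
  `LiuZhangZhang2018.thm151_thm153_*` (χ = 𝟙 side typed)]
* W2 IDEA-NEEDED — currency matching on the anticyclotomic line: `𝓛_{LZZ}(χ) = u(χ)·𝒫_{Hsieh}(χ)²·c` with `v₃(u(χ))` explicit and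
  bounded (`c` = the fixed transcendental-free constant `s·c²w_K²√d_K/(2h_K²)` after the tree readings R-M/R-Ad/R-CNF).  Unprinted;
  shared with the X2 kernel consumer (p502241) and subject to audit flag F-g10-LZZ-RL (is the tree reading (R-L) — ONE analytic
  function interpolating transcendental values for EVERY `ι` — consistent?).
* W3 TREE FACT — `Hsieh2014.thmB_exists_isHsiehLFunction_coeff_norm_eq_one_unrPeriod_anyLevel` (`p` odd, level-blind: arXiv:1112.1580
  Thm. 2, §3.6.2, §6) + §1 `UnrSeries.exists_radius_norm_value_eq_pow`: `v₃(𝒫_{Hsieh}(χ)) = λ/φ(3ⁿ)` for primitive `χ` of conductor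
  `3ⁿ`, `n ≫ 0`.
* W4 ATTACKABLE — height-one χ-isotypic Kummer lemma and constant bookkeeping: `a₃ = ±1`, `Ê′ ≅ 𝔾̂_m` (twisted), `μ₃ ⊂ K_𝔭(E′[3]) ⊂
  K[3]_𝔓`; `(U¹⊗O_χ)^χ` free of rank one mod torsion; `v(e_χ log u) < 1 + v(log g_χ)` ⟹ `u ∉ 3U + tors`; Gauss sum `k/2`, Euler factor
  `−2`, `ε` a unit, CST Prop. 3.12 (`c > 0` rows) — all `O(1)`, against the LHS drop `λ/φ(3ⁿ) → 0` and the divisibility threshold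
  growing like `n`.  ⟹ K1‴ at layer `k = n − 1`.
* W5 INSTRUMENTABLE — I-g10-1: `v₃` of χ-twisted log sums at conductor `9, 27` on `15a1/ℚ(√−11)` (habitat `Negative/Habitat.lean`).
Why it might fail: W2 may be false as a bounded-unit matching (LZZ's `𝓛` lives in the unbounded distribution algebra `𝒟(G,π)`; the
`W`-factor `w(0,n)` of reading (L3)); W4's `O(1)` constants must not eat the margin at the FIRST usable layer if one insists on small `k`
(irrelevant asymptotically).  [cite: CastellaHsieh2018, Thm. 4.8 (shape at `p ∤ N`)] [cite: Hsieh2014, Thm. B] -/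
theorem stub_principalHeegner : UniversalToricDescentBetaRoadParamDefs.PrincipalHeegnerIndivisibleMultOfParamAtThree := by
  sorry

/-- **stub K2a‴** (`KsTwinLambdaAdicAtThree`, item stmt-BirchSwinnertonDyer-32864, aside/LINE-RESIDUAL) — UNDECIDED · BARRIER-class leaf
(`Literature.Barriers.BirchSwinnertonDyer.EulerSystemBigImageAtSmallImage`: Howard's Λ-adic Kolyvagin-system machine at `p = 3 ∥ N′`,
outside print; audit g53).  Untouched by this node. [cite: Howard2004HeegnerKolyvagin, Thm. 2.3.1, Thm. B] -/
theorem stub_ksTwinLambda : UniversalToricDescentKsTwinLambdaDefs.KsTwinLambdaAdicAtThree := by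
  sorry

/-- **stub C₀′** — the registered good-supersingular constant of line `beta-road` v19 BY NAME (untouched by this node; its own finite-layer
sibling is row 10 `one-point-squeeze`). -/
theorem stub_goodSS : UniversalToricDescentBetaRoadParamDefs.TwinAlgMuZeroAtThreeGoodSSOfParam := by
  sorry

/-! ## §4 Composition: the crux BY NAME -/

/-- **Crux 24737 `TwinAlgMuZeroAtThree` BY NAME from K1‴, K2a‴, C₀′** (the line of record's composition
`twinAlgMuZeroAtThree_of_betaRoadParamStubs`, p776836; this node re-plans ONLY the sub-tree under K1‴).  Kernel-checked; no `sorry`. -/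
theorem TwinAlgMuZeroAtThree_of
    (hK1 : UniversalToricDescentBetaRoadParamDefs.PrincipalHeegnerIndivisibleMultOfParamAtThree)
    (hK2 : UniversalToricDescentKsTwinLambdaDefs.KsTwinLambdaAdicAtThree)
    (hC0 : UniversalToricDescentBetaRoadParamDefs.TwinAlgMuZeroAtThreeGoodSSOfParam) :
    Summit.BirchSwinnertonDyer.BirchSwinnertonDyer.Theses.UniversalToricDescent.TwinAlgMuZeroAtThree :=
  UniversalToricDescentTwinAlgMuZeroAtThreeOfBetaRoadParam.twinAlgMuZeroAtThree_of_betaRoadParamStubs hK1 hK2 hC0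

/-- **The node closes the crux from its three stubs** (inherits their `sorry`s). -/
theorem TwinAlgMuZeroAtThree_of_stubs :
    Summit.BirchSwinnertonDyer.BirchSwinnertonDyer.Theses.UniversalToricDescent.TwinAlgMuZeroAtThree :=
  TwinAlgMuZeroAtThree_of stub_principalHeegner stub_ksTwinLambda stub_goodSS

end Summit.BirchSwinnertonDyer.BirchSwinnertonDyer.Cruxes.TwinAlgMuZeroAtThree.LzzCharacterSqueeze

end
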